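import Literature.AlgebraicGeometry.Morphisms.NormalisedGeneratorCoface
import Literature.AlgebraicGeometry.Morphisms.SectionsFpqcDescent
import Literature.AlgebraicGeometry.Modules.PullbackReflectsIsoOfFlatSurjective
import Literature.AlgebraicGeometry.Modules.LinearOverBase
import HarnessLib

/-!
# fpqc descent of a trivialisation normalised along a section (generic core of HECKE-LINK D6 brick (u6b))

Topic `Literature/AlgebraicGeometry/Morphisms`, namespace `Literature.AlgebraicGeometry.Morphisms`.  THEOREMS ONLY; no
definition, no named fact, no instance, no notation, no `sorry`.  Sequel of ★ `Morphisms/NormalisedGeneratorCoface`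
(setting and notation there): the kernel-pair level `p₁, p₂ : Z₂ ⇉ Z` over `pr₁, pr₂ : T₂ ⇉ T₁`, with a section
`e₂ : T₂ → Z₂` of `π₂`, `e₂ ≫ pᵢ = prᵢ ≫ e₁`, `pᵢ ≫ π₁ = π₂ ≫ prᵢ`, `pr₂ ≫ c = pr₁ ≫ c`, `H : p₂ ≫ g = p₁ ≫ g`.

* §3 `unitSection_cofaceFst_eq_unitSection_cofaceSnd` — the two cofaces `t₁ = C_{p₁,g}(η_{p₁} s₁)`,
  `t₂ = T_H(C_{p₂,g}(η_{p₂} s₁))` of a NORMALISED generator have the same pull-back along `e₂` (LEMMA Y twice +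
  `pr₁ ≫ c = pr₂ ≫ c`); **`cofaceFst_eq_cofaceSnd_of_stein`** — with STEIN at `T₂` (`π₂♯` onto on global functions)
  they are EQUAL: the two trivialisations of `(p₁ ≫ g)^*L` differ by a unit `w′ = π₂♯ v`, and `v = 1`-type bookkeeping
  along `e₂` where `η_{e₂}(β₁⁻¹ 1)` is torsion-free ([MumfordAV1970] §5 Cor. 6 / [GortzWedhorn2023] Lemma 24.67: the
  seesaw use of `𝒪_T ⥲ π_*𝒪`);
* §4 `exists_hom_unit_app_eq_smul` (the morphism `𝒪_X → L`, `r ↦ r • m|`, of a global section) and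
  **`nonempty_iso_unit_of_cofaceFst_eq_cofaceSnd`** — for `g` AFFINE, flat, surjective with a kernel pair and `L`
  quasi-coherent: if the cofaces of `s₁ = φ₀⁻¹(u)` (`u` a unit) agree then `L ≅ 𝒪_X` (descend `s₁ = η_g(m)` by ★ p749447
  `Morphisms/SectionsFpqcDescent.existsUnique_unitSection_eq`; `g^*σ_m = u_g ≫ (· u) ≫ φ₀⁻¹` is an isomorphism, hence so
  is `σ_m` by ★ `Modules/PullbackReflectsIsoOfFlatSurjective`).

HC_CM is proved only modulo the 7 printed citations until rung 0 closes; nothing here is about HC.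

## References
* [MumfordAV1970] D. Mumford, *Abelian Varieties* (1970), §13 (p. 125), §5 Cor. 6 (p. 54).
* [SGA1] A. Grothendieck, *SGA 1*, Exp. VIII §1, Thm. 1.1, Cor. 1.2.
* [StacksProject] The Stacks Project, Tag 023M (Descent, Lemma 35.3.6).
* [GortzWedhorn2020] U. Görtz, T. Wedhorn, *Algebraic Geometry I*, 2nd ed. (2020), Prop. 14.66, Thm. 14.68.
* [GortzWedhorn2023] U. Görtz, T. Wedhorn, *Algebraic Geometry II* (2023), Lemma 24.67 (pp. 543–544).
* [Hartshorne1977] R. Hartshorne, *Algebraic Geometry*, GTM 52 (1977), II §5 (pp. 109–110).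
-/

noncomputable section

-- `TopCat.Presheaf`/`Scheme.Modules` are not reducible (as in Mathlib's `AlgebraicGeometry/Modules`).
set_option backward.isDefEq.respectTransparency false

universe u

open CategoryTheory CategoryTheory.Limits AlgebraicGeometry TopologicalSpace Opposite

namespace Literature.AlgebraicGeometry.Morphisms

open Literature.AlgebraicGeometry.Modules

/-! ## §3 The two cofaces of the normalised generator agree -/

section Cofaces

variable {X T Z T₁ Z₂ T₂ : Scheme.{u}} (e : T ⟶ X) (g : Z ⟶ X) (e₁ : T₁ ⟶ Z) (π₁ : Z ⟶ T₁) (c : T₁ ⟶ T)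
  (L : X.Modules) (ρ : (Scheme.Modules.pullback e).obj L ≅ SheafOfModules.unit T.ringCatSheaf)
  (φ₀ : (Scheme.Modules.pullback g).obj L ≅ SheafOfModules.unit Z.ringCatSheaf)
  (p₁ p₂ : Z₂ ⟶ Z) (e₂ : T₂ ⟶ Z₂) (π₂ : Z₂ ⟶ T₂) (pr₁ pr₂ : T₂ ⟶ T₁)

/-- **The two cofaces of a normalised generator have the same pull-back along the section `e₂`.**  Kernel-pair
level: `p₁, p₂ : Z₂ ⇉ Z` over `pr₁, pr₂ : T₂ ⇉ T₁` with sections `e₂ ≫ pᵢ = prᵢ ≫ e₁`, `pr₂ ≫ c = pr₁ ≫ c` and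
`H : p₂ ≫ g = p₁ ≫ g`.  For a global section `s₁` of `g^*L` normalised along `e₁` (`hs₁`), the two cofaces
`t₁ := C_{p₁,g}(η_{p₁} s₁)` and `t₂ := T_H(C_{p₂,g}(η_{p₂} s₁))` of `(p₁ ≫ g)^*L` satisfy `η_{e₂}(t₁) = η_{e₂}(t₂)`: by LEMMA Y
both `(e₂ ≫ p₁ ≫ g)^*`-readings are transports of `η_{prᵢ ≫ c}(ρ⁻¹ 1)`, and `pr₁ ≫ c = pr₂ ≫ c`.
[cite: StacksProject, Tag 023M] [cite: GortzWedhorn2020, Prop. 14.66] -/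
theorem unitSection_cofaceFst_eq_unitSection_cofaceSnd (h₁ : e₁ ≫ g = c ≫ e)
    (hp₁ : e₂ ≫ p₁ = pr₁ ≫ e₁) (hp₂ : e₂ ≫ p₂ = pr₂ ≫ e₁) (hpr : pr₂ ≫ c = pr₁ ≫ c) (H : p₂ ≫ g = p₁ ≫ g)
    (s₁ : Γ((Scheme.Modules.pullback g).obj L, ⊤))
    (hs₁ : ((Scheme.Modules.pullbackCongr h₁).hom.app L).app ⊤
        (((Scheme.Modules.pullbackComp e₁ g).hom.app L).app ⊤
          (unitSection e₁ ((Scheme.Modules.pullback g).obj L) ⊤ s₁)) =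
      ((Scheme.Modules.pullbackComp c e).hom.app L).app ⊤
        (unitSection c ((Scheme.Modules.pullback e).obj L) ⊤ (ρ.inv.app ⊤ (1 : Γ(T, ⊤))))) :
    unitSection e₂ ((Scheme.Modules.pullback (p₁ ≫ g)).obj L) ⊤
        (((Scheme.Modules.pullbackComp p₁ g).hom.app L).app ⊤
          (unitSection p₁ ((Scheme.Modules.pullback g).obj L) ⊤ s₁)) =
      unitSection e₂ ((Scheme.Modules.pullback (p₁ ≫ g)).obj L) ⊤
        (((Scheme.Modules.pullbackCongr H).hom.app L).app ⊤
          (((Scheme.Modules.pullbackComp p₂ g).hom.app L).app ⊤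
            (unitSection p₂ ((Scheme.Modules.pullback g).obj L) ⊤ s₁))) := by
  -- `D := C_{e₂, p₁ ≫ g}` is injective
  apply app_injective_of_iso ((Scheme.Modules.pullbackComp e₂ (p₁ ≫ g)).app L) ⊤
  change ((Scheme.Modules.pullbackComp e₂ (p₁ ≫ g)).hom.app L).app ⊤ _ =
    ((Scheme.Modules.pullbackComp e₂ (p₁ ≫ g)).hom.app L).app ⊤ _
  -- LEMMA Y for the first coface
  have Y₁ := unitSection_coface_eq_transport e g e₁ c L ρ e₂ p₁ pr₁ s₁ h₁ hp₁ hs₁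
  -- LEMMA Y for the second coface, after moving `T_H` across `η_{e₂}` and `C_{e₂, p₁ ≫ g}`
  have nat : unitSection e₂ ((Scheme.Modules.pullback (p₁ ≫ g)).obj L) ⊤
        (((Scheme.Modules.pullbackCongr H).hom.app L).app ⊤
          (((Scheme.Modules.pullbackComp p₂ g).hom.app L).app ⊤
            (unitSection p₂ ((Scheme.Modules.pullback g).obj L) ⊤ s₁))) =
      ((Scheme.Modules.pullback e₂).map ((Scheme.Modules.pullbackCongr H).hom.app L)).app ⊤
        (unitSection e₂ ((Scheme.Modules.pullback (p₂ ≫ g)).obj L) ⊤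
          (((Scheme.Modules.pullbackComp p₂ g).hom.app L).app ⊤
            (unitSection p₂ ((Scheme.Modules.pullback g).obj L) ⊤ s₁))) :=
    (pullback_map_app_top_unitSection_top e₂ ((Scheme.Modules.pullbackCongr H).hom.app L) _).symm
  have mv := pullbackComp_hom_app_app_pullback_map_pullbackCongr e₂ H L ⊤
    (unitSection e₂ ((Scheme.Modules.pullback (p₂ ≫ g)).obj L) ⊤
      (((Scheme.Modules.pullbackComp p₂ g).hom.app L).app ⊤
        (unitSection p₂ ((Scheme.Modules.pullback g).obj L) ⊤ s₁)))
  have Y₂ := unitSection_coface_eq_transport e g e₁ c L ρ e₂ p₂ pr₂ s₁ h₁ hp₂ hs₁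
  have base := pullbackComp_hom_app_unitSection_congr_base hpr e L (ρ.inv.app ⊤ (1 : Γ(T, ⊤)))
  rw [Y₁, nat, mv, Y₂, base, pullbackCongr_hom_app_app_trans, pullbackCongr_hom_app_app_trans]

/-- **Stein + rigidification ⇒ the two cofaces of the normalised generator AGREE.**  In the setting of
`unitSection_cofaceFst_eq_unitSection_cofaceSnd`, assume moreover that `e₂` is a section of `π₂ : Z₂ → T₂`, that
`pᵢ ≫ π₁ = π₂ ≫ prᵢ`, and STEIN at `T₂`: every global function on `Z₂` comes from `T₂` (`π₂♯` onto).  Then for the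
normalised generator `s₁ := φ₀⁻¹(π₁♯ a)` the two cofaces `t₁ = C_{p₁,g}(η_{p₁} s₁)` and `t₂ = T_H(C_{p₂,g}(η_{p₂} s₁))` are
EQUAL: both trivialisations `βᵢ` of `(p₁ ≫ g)^*L` (from `φ₀` through `pᵢ`) send `tᵢ` to `π₂♯(prᵢ♯ a)`; `t₂ = (w′·β₂(t₂)) • β₁⁻¹(1)`
with `w′ = β₁(β₂⁻¹ 1) = π₂♯ v` (Stein); pulling back along `e₂` (where the two cofaces agree, previous lemma) and using
that `η_{e₂}(β₁⁻¹ 1)` is torsion-free gives `pr₁♯ a = v · pr₂♯ a`, whence `β₁(t₁) = β₁(t₂)`.  ([MumfordAV1970] §5 / [GortzWedhorn2023]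
Lemma 24.67: the seesaw use of `𝒪_T ⥲ π_*𝒪_{X}`.) [cite: StacksProject, Tag 023M] [cite: GortzWedhorn2020, Prop. 14.66] -/
theorem cofaceFst_eq_cofaceSnd_of_stein (h₁ : e₁ ≫ g = c ≫ e)
    (hp₁ : e₂ ≫ p₁ = pr₁ ≫ e₁) (hp₂ : e₂ ≫ p₂ = pr₂ ≫ e₁) (hpr : pr₂ ≫ c = pr₁ ≫ c) (H : p₂ ≫ g = p₁ ≫ g)
    (he₂ : e₂ ≫ π₂ = 𝟙 T₂) (hq₁ : p₁ ≫ π₁ = π₂ ≫ pr₁) (hq₂ : p₂ ≫ π₁ = π₂ ≫ pr₂)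
    (hSt : Function.Surjective (π₂.app ⊤)) (a : Γ(T₁, ⊤))
    (hs₁ : ((Scheme.Modules.pullbackCongr h₁).hom.app L).app ⊤
        (((Scheme.Modules.pullbackComp e₁ g).hom.app L).app ⊤
          (unitSection e₁ ((Scheme.Modules.pullback g).obj L) ⊤ (φ₀.inv.app ⊤ (π₁.app ⊤ a)))) =
      ((Scheme.Modules.pullbackComp c e).hom.app L).app ⊤
        (unitSection c ((Scheme.Modules.pullback e).obj L) ⊤ (ρ.inv.app ⊤ (1 : Γ(T, ⊤))))) :
    ((Scheme.Modules.pullbackComp p₁ g).hom.app L).app ⊤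
        (unitSection p₁ ((Scheme.Modules.pullback g).obj L) ⊤ (φ₀.inv.app ⊤ (π₁.app ⊤ a))) =
      ((Scheme.Modules.pullbackCongr H).hom.app L).app ⊤
        (((Scheme.Modules.pullbackComp p₂ g).hom.app L).app ⊤
          (unitSection p₂ ((Scheme.Modules.pullback g).obj L) ⊤ (φ₀.inv.app ⊤ (π₁.app ⊤ a)))) := by
  haveI := isIso_pullbackUnitComparison p₁
  haveI := isIso_pullbackUnitComparison p₂
  haveI := isIso_pullbackUnitComparison e₂
  -- the two trivialisations of `N₂ := (p₁ ≫ g)^*L`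
  let β₁ : (Scheme.Modules.pullback (p₁ ≫ g)).obj L ≅ SheafOfModules.unit Z₂.ringCatSheaf :=
    ((Scheme.Modules.pullbackComp p₁ g).app L).symm ≪≫ (Scheme.Modules.pullback p₁).mapIso φ₀ ≪≫
      asIso (pullbackUnitComparison p₁)
  let β₂ : (Scheme.Modules.pullback (p₁ ≫ g)).obj L ≅ SheafOfModules.unit Z₂.ringCatSheaf :=
    ((Scheme.Modules.pullbackCongr H).app L).symm ≪≫ ((Scheme.Modules.pullbackComp p₂ g).app L).symm ≪≫
      (Scheme.Modules.pullback p₂).mapIso φ₀ ≪≫ asIso (pullbackUnitComparison p₂)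
  -- the values of `βᵢ` on the cofaces `tᵢ`
  have hb₁ : (show Γ(Z₂, ⊤) from β₁.hom.app ⊤ (((Scheme.Modules.pullbackComp p₁ g).hom.app L).app ⊤
        (unitSection p₁ ((Scheme.Modules.pullback g).obj L) ⊤ (φ₀.inv.app ⊤ (π₁.app ⊤ a))))) =
      p₁.app ⊤ (π₁.app ⊤ a) := by
    change (pullbackUnitComparison p₁).app ⊤ (((Scheme.Modules.pullback p₁).map φ₀.hom).app ⊤
      (((Scheme.Modules.pullbackComp p₁ g).inv.app L).app ⊤ (((Scheme.Modules.pullbackComp p₁ g).hom.app L).app ⊤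
        (unitSection p₁ ((Scheme.Modules.pullback g).obj L) ⊤ (φ₀.inv.app ⊤ (π₁.app ⊤ a)))))) = _
    rw [natIso_inv_app_app_hom_app_app, pullback_map_app_top_unitSection_top, hom_app_inv_app]
    exact app_pullbackUnitComparison_unitSection p₁ ⊤ (π₁.app ⊤ a)
  have hb₂ : (show Γ(Z₂, ⊤) from β₂.hom.app ⊤ (((Scheme.Modules.pullbackCongr H).hom.app L).app ⊤
        (((Scheme.Modules.pullbackComp p₂ g).hom.app L).app ⊤
          (unitSection p₂ ((Scheme.Modules.pullback g).obj L) ⊤ (φ₀.inv.app ⊤ (π₁.app ⊤ a)))))) =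
      p₂.app ⊤ (π₁.app ⊤ a) := by
    change (pullbackUnitComparison p₂).app ⊤ (((Scheme.Modules.pullback p₂).map φ₀.hom).app ⊤
      (((Scheme.Modules.pullbackComp p₂ g).inv.app L).app ⊤ (((Scheme.Modules.pullbackCongr H).inv.app L).app ⊤
        (((Scheme.Modules.pullbackCongr H).hom.app L).app ⊤ (((Scheme.Modules.pullbackComp p₂ g).hom.app L).app ⊤
          (unitSection p₂ ((Scheme.Modules.pullback g).obj L) ⊤ (φ₀.inv.app ⊤ (π₁.app ⊤ a)))))))) = _
    rw [natIso_inv_app_app_hom_app_app, natIso_inv_app_app_hom_app_app, pullback_map_app_top_unitSection_top,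
      hom_app_inv_app]
    exact app_pullbackUnitComparison_unitSection p₂ ⊤ (π₁.app ⊤ a)
  have from_base₁ : (show Γ(Z₂, ⊤) from p₁.app ⊤ (π₁.app ⊤ a)) = π₂.app ⊤ (pr₁.app ⊤ a) := app_app_top_congr hq₁ a
  have from_base₂ : (show Γ(Z₂, ⊤) from p₂.app ⊤ (π₁.app ⊤ a)) = π₂.app ⊤ (pr₂.app ⊤ a) := app_app_top_congr hq₂ a
  dsimp only at hb₁ hb₂ from_base₁ from_base₂
  rw [from_base₁] at hb₁
  rw [from_base₂] at hb₂
  -- STEIN: `w′ := β₁(β₂⁻¹ 1)` comes from `T₂`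
  obtain ⟨v, hv⟩ := hSt (β₁.hom.app ⊤ (β₂.inv.app ⊤ (1 : Γ(Z₂, ⊤))))
  -- `β₁(t₂) = w′ · β₂(t₂) = π₂♯(v · pr₂♯ a)`
  have hb₁₂ := hom_app_eq_mul_hom_app ⊤ β₂ β₁ (((Scheme.Modules.pullbackCongr H).hom.app L).app ⊤
        (((Scheme.Modules.pullbackComp p₂ g).hom.app L).app ⊤
          (unitSection p₂ ((Scheme.Modules.pullback g).obj L) ⊤ (φ₀.inv.app ⊤ (π₁.app ⊤ a)))))
  dsimp only at hb₁₂
  have hm : @HMul.hMul Γ(Z₂, ⊤) Γ(Z₂, ⊤) Γ(Z₂, ⊤) instHMul (π₂.app ⊤ v) (π₂.app ⊤ (pr₂.app ⊤ a)) =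
      π₂.app ⊤ (@HMul.hMul Γ(T₂, ⊤) Γ(T₂, ⊤) Γ(T₂, ⊤) instHMul v (pr₂.app ⊤ a)) :=
    (map_mul (π₂.app ⊤).hom v _).symm
  rw [hb₂, ← hv, hm] at hb₁₂
  -- the decompositions `tᵢ = β₁(tᵢ) • β₁⁻¹(1)` inserted in the `e₂`-pull-back equation
  have hE := unitSection_cofaceFst_eq_unitSection_cofaceSnd e g e₁ c L ρ p₁ p₂ e₂ pr₁ pr₂ h₁ hp₁ hp₂ hpr H
    (φ₀.inv.app ⊤ (π₁.app ⊤ a)) hs₁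
  have d₁ := eq_smul_inv_app_one β₁ ⊤ (((Scheme.Modules.pullbackComp p₁ g).hom.app L).app ⊤
        (unitSection p₁ ((Scheme.Modules.pullback g).obj L) ⊤ (φ₀.inv.app ⊤ (π₁.app ⊤ a))))
  have d₂ := eq_smul_inv_app_one β₁ ⊤ (((Scheme.Modules.pullbackCongr H).hom.app L).app ⊤
        (((Scheme.Modules.pullbackComp p₂ g).hom.app L).app ⊤
          (unitSection p₂ ((Scheme.Modules.pullback g).obj L) ⊤ (φ₀.inv.app ⊤ (π₁.app ⊤ a)))))
  dsimp only at d₁ d₂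
  rw [hb₁] at d₁
  rw [hb₁₂] at d₂
  rw [d₁, d₂, unitSection_smul, unitSection_smul] at hE
  have s₁' : e₂.app ⊤ (π₂.app ⊤ (pr₁.app ⊤ a)) = pr₁.app ⊤ a := app_app_top_of_comp_eq_id e₂ π₂ he₂ _
  have s₂' : e₂.app ⊤ (π₂.app ⊤ (@HMul.hMul Γ(T₂, ⊤) Γ(T₂, ⊤) Γ(T₂, ⊤) instHMul v (pr₂.app ⊤ a))) =
      @HMul.hMul Γ(T₂, ⊤) Γ(T₂, ⊤) Γ(T₂, ⊤) instHMul v (pr₂.app ⊤ a) := app_app_top_of_comp_eq_id e₂ π₂ he₂ _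
  rw [s₁', s₂'] at hE
  -- `η_{e₂}(β₁⁻¹ 1)` is the generator of the trivialisation `γ₂ := e₂^*β₁ ≫ u_{e₂}` of `e₂^*N₂`: torsion-free
  let γ₂ : (Scheme.Modules.pullback e₂).obj ((Scheme.Modules.pullback (p₁ ≫ g)).obj L) ≅
      SheafOfModules.unit T₂.ringCatSheaf :=
    (Scheme.Modules.pullback e₂).mapIso β₁ ≪≫ asIso (pullbackUnitComparison e₂)
  have hG : unitSection e₂ ((Scheme.Modules.pullback (p₁ ≫ g)).obj L) ⊤ (β₁.inv.app ⊤ (1 : Γ(Z₂, ⊤))) =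
      γ₂.inv.app ⊤ (1 : Γ(T₂, ⊤)) := by
    change _ = ((Scheme.Modules.pullback e₂).map β₁.inv).app ⊤
      ((inv (pullbackUnitComparison e₂)).app ⊤ (1 : Γ(T₂, ⊤)))
    rw [inv_pullbackUnitComparison_app_top_one e₂, pullback_map_app_top_unitSection_top]
  rw [hG] at hE
  have hinj := smul_inv_app_one_injective γ₂ ⊤ hE
  -- conclude: `β₁(t₁) = π₂♯(pr₁♯ a) = π₂♯(v · pr₂♯ a) = β₁(t₂)`
  rw [d₁, d₂, hinj]

end Cofaces

/-! ## §4 Descent of a generator whose cofaces agree: the module is trivial -/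

section Descent

variable {X Z Z₂ : Scheme.{u}} (g : Z ⟶ X) (p₁ p₂ : Z₂ ⟶ Z) (L : X.Modules)
  (φ₀ : (Scheme.Modules.pullback g).obj L ≅ SheafOfModules.unit Z.ringCatSheaf)

/-- **The morphism `𝒪_X ⟶ L` of a global section `m`**, `r ↦ r • m|_U` (existence with its section formula; the map of
Mathlib's `SheafOfModules.unitHomEquiv`, spelled out). [cite: Hartshorne1977, II §5 (pp. 109–110)] -/
theorem exists_hom_unit_app_eq_smul (m : Γ(L, ⊤)) :
    ∃ σ : unitModule X ⟶ L,
      ∀ (U : X.Opens) (r : Γ(X, U)), σ.app U r = r • L.presheaf.map (homOfLE (le_top : U ≤ ⊤)).op m := by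
  refine ⟨⟨PresheafOfModules.homMk
    { app := fun U => AddCommGrpCat.ofHom
        { toFun := fun r =>
            ((show Γ(X, U.unop) from r) • L.presheaf.map (homOfLE (le_top : U.unop ≤ ⊤)).op m : Γ(L, U.unop))
          map_zero' := by
            change (0 : Γ(X, U.unop)) • L.presheaf.map (homOfLE (le_top : U.unop ≤ ⊤)).op m = 0
            exact zero_smul _ _
          map_add' := fun r r' => by
            change ((show Γ(X, U.unop) from r) + (show Γ(X, U.unop) from r')) •
                L.presheaf.map (homOfLE (le_top : U.unop ≤ ⊤)).op m = _
            exact add_smul _ _ _ }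
      naturality := fun {U V} i => by
        ext r
        change ((show Γ(X, V.unop) from X.presheaf.map i r) •
            L.presheaf.map (homOfLE (le_top : V.unop ≤ ⊤)).op m : Γ(L, V.unop)) =
          L.presheaf.map i.unop.op ((show Γ(X, U.unop) from r) • L.presheaf.map (homOfLE (le_top : U.unop ≤ ⊤)).op m)
        have e1 : L.presheaf.map (homOfLE (le_top : V.unop ≤ ⊤)).op m =
            L.presheaf.map i.unop.op (L.presheaf.map (homOfLE (le_top : U.unop ≤ ⊤)).op m) := by
          rw [← CategoryTheory.comp_apply, ← Functor.map_comp]; rfl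
        rw [e1]
        exact (Scheme.Modules.map_smul L i.unop (show Γ(X, U.unop) from r) _).symm }
    (fun U a r => by
      change (@HMul.hMul Γ(X, U.unop) Γ(X, U.unop) Γ(X, U.unop) instHMul a r) •
          L.presheaf.map (homOfLE (le_top : U.unop ≤ ⊤)).op m =
        (show Γ(X, U.unop) from a) • ((show Γ(X, U.unop) from r) • L.presheaf.map (homOfLE (le_top : U.unop ≤ ⊤)).op m)
      exact mul_smul _ _ _)⟩, fun U r => rfl⟩

/-- **fpqc descent of a trivialisation.**  Let `g : Z → X` be affine, flat and surjective with a kernel pair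
`p₁, p₂ : Z₂ ⇉ Z` (`IsPullback p₁ p₂ g g`), `L` a quasi-coherent `𝒪_X`-module whose pull-back is trivial,
`φ₀ : g^*L ≅ 𝒪_Z`, and `u` a global unit on `Z` such that the two cofaces of the generator `s₁ := φ₀⁻¹(u)` AGREE (as global
sections of `(p₁ ≫ g)^*L`).  Then `L ≅ 𝒪_X`: `s₁ = η_g(m)` descends by ★ p749447 `existsUnique_unitSection_eq`; the morphism
`σ_m : 𝒪_X → L` pulls back to `u_g ≫ (· u) ≫ φ₀⁻¹`, an isomorphism, so `σ_m` is an isomorphism (★ `isIso_of_isIso_pullback_map`,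
`g` flat surjective). [cite: StacksProject, Tag 023M] [cite: GortzWedhorn2020, Prop. 14.66] [cite: SGA1, Exp. VIII Thm. 1.1, Cor. 1.2] -/
theorem nonempty_iso_unit_of_cofaceFst_eq_cofaceSnd [IsAffineHom g] [Flat g] [Surjective g] [L.IsQuasicoherent]
    (H₂ : IsPullback p₁ p₂ g g) (u : Γ(Z, ⊤)) (hu : IsUnit u)
    (hcof : ((Scheme.Modules.pullbackComp p₁ g).hom.app L).app ⊤
        (unitSection p₁ ((Scheme.Modules.pullback g).obj L) ⊤ (φ₀.inv.app ⊤ u)) =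
      ((Scheme.Modules.pullbackCongr H₂.w.symm).hom.app L).app ⊤
        (((Scheme.Modules.pullbackComp p₂ g).hom.app L).app ⊤
          (unitSection p₂ ((Scheme.Modules.pullback g).obj L) ⊤ (φ₀.inv.app ⊤ u)))) :
    Nonempty (L ≅ SheafOfModules.unit X.ringCatSheaf) := by
  haveI := isIso_pullbackUnitComparison g
  -- (1) descend the generator `s₁ := φ₀⁻¹(u)` along `g` (★ p749447)
  have hcof' : (((Scheme.Modules.pullbackComp p₁ g).hom.app L).app (p₁ ⁻¹ᵁ (g ⁻¹ᵁ ⊤))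
        (unitSection p₁ ((Scheme.Modules.pullback g).obj L) (g ⁻¹ᵁ ⊤) (φ₀.inv.app ⊤ u)) :
          Γ((Scheme.Modules.pullback (p₁ ≫ g)).obj L, p₁ ⁻¹ᵁ (g ⁻¹ᵁ ⊤))) =
      (((Scheme.Modules.pullbackCongr H₂.w.symm).hom.app L).app (p₂ ⁻¹ᵁ (g ⁻¹ᵁ ⊤))
        (((Scheme.Modules.pullbackComp p₂ g).hom.app L).app (p₂ ⁻¹ᵁ (g ⁻¹ᵁ ⊤))
          (unitSection p₂ ((Scheme.Modules.pullback g).obj L) (g ⁻¹ᵁ ⊤) (φ₀.inv.app ⊤ u))) :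
          Γ((Scheme.Modules.pullback (p₁ ≫ g)).obj L, p₁ ⁻¹ᵁ (g ⁻¹ᵁ ⊤))) := hcof
  obtain ⟨m, hm, -⟩ := existsUnique_unitSection_eq g p₁ p₂ L ⊤ H₂ (φ₀.inv.app ⊤ u) (by
    rw [hcof']
    exact presheaf_map_congr _ _ _ _)
  -- (2) the morphism `σ_m : 𝒪_X → L`
  obtain ⟨σ, hσ⟩ := exists_hom_unit_app_eq_smul L m
  -- (3) `g^* σ_m = u_g ≫ (· u) ≫ φ₀⁻¹`
  have key : (Scheme.Modules.pullback g).map σ =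
      pullbackUnitComparison g ≫ globalScalar _ u ≫ φ₀.inv := by
    refine pullbackObj_hom_ext_unitSection' g _ _ fun V y => ?_
    rw [pullback_map_app_unitSection, hσ, unitSection_smul, unitSection_map, hm,
      Scheme.Modules.Hom.comp_app (pullbackUnitComparison g), CategoryTheory.comp_apply,
      app_pullbackUnitComparison_unitSection, Scheme.Modules.Hom.comp_app (globalScalar _ u) φ₀.inv,
      CategoryTheory.comp_apply, globalScalar_app_apply]
    have e2 : (Z.presheaf.map (homOfLE (le_top : g ⁻¹ᵁ V ≤ ⊤)).op u) • (g.app V y : Γ(unitModule Z, g ⁻¹ᵁ V)) =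
        g.app V y • (Scheme.Modules.presheaf (unitModule Z)).map (homOfLE (le_top : g ⁻¹ᵁ V ≤ ⊤)).op u := by
      change @HMul.hMul Γ(Z, g ⁻¹ᵁ V) Γ(Z, g ⁻¹ᵁ V) Γ(Z, g ⁻¹ᵁ V) instHMul
          (Z.presheaf.map (homOfLE (le_top : g ⁻¹ᵁ V ≤ ⊤)).op u) (g.app V y) =
        @HMul.hMul Γ(Z, g ⁻¹ᵁ V) Γ(Z, g ⁻¹ᵁ V) Γ(Z, g ⁻¹ᵁ V) instHMul
          (g.app V y) (Z.presheaf.map (homOfLE (le_top : g ⁻¹ᵁ V ≤ ⊤)).op u)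
      exact mul_comm _ _
    rw [e2, Scheme.Modules.Hom.app_smul, app_presheaf_map φ₀.inv]
    congr 1
  -- (4) `g^* σ_m` is an isomorphism, hence so is `σ_m`
  haveI : IsIso (globalScalar (SheafOfModules.unit Z.ringCatSheaf) u) :=
    ⟨⟨globalScalar _ (↑hu.unit⁻¹ : Γ(Z, ⊤)), by rw [← globalScalar_mul, IsUnit.val_inv_mul, globalScalar_one],
      by rw [← globalScalar_mul, IsUnit.mul_val_inv, globalScalar_one]⟩⟩
  haveI : IsIso ((Scheme.Modules.pullback g).map σ) := by rw [key]; infer_instance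
  haveI : IsIso σ := isIso_of_isIso_pullback_map g σ
  exact ⟨(asIso σ).symm⟩

end Descent

end Literature.AlgebraicGeometry.Morphisms

end
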